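import Mathlib.LinearAlgebra.Dimension.Finrank
import Mathlib.LinearAlgebra.FiniteDimensional.Defs
import Mathlib.LinearAlgebra.Dimension.Finite
import Mathlib.LinearAlgebra.FiniteDimensional.Lemmas
import Mathlib.RingTheory.Length
import HarnessLib

/-!
# Isotropic submodules of a split plane and the counting skeleton of Howard 2004, Lemma 1.5.3 («parity»)

Topic `Algebra/Module`; namespace `Literature.Algebra.Module`. THEOREMS ONLY: no definition, no named fact,
no instance, no notation, no `sorry`; Mathlib only.

Cell `pub/bsd-print-x9`, print leaf G87 `Literature.NumberTheory.GaloisCohomology.Howard2004.thm161_dvrKolyvaginBound`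
(Howard 2004, Thm. 1.6.1), whose remaining printed Galois input Lemma 1.6.4 inducts on the residual Selmer
ranks `ρ(n)^±` through Lemma 1.5.3. This file is the module-theoretic content of that lemma, separated from
its Galois-cohomological inputs (global duality, reciprocity, H.4/H.5), which enter as the hypotheses
named below.

SOURCE, verbatim. B. Howard, *The Heegner point Kolyvagin system*, Compositio Math. **140** (2004),
Lemma 1.5.3 (= arXiv:1202.6340 Lemma 2.5.3, held text p0009 L139 – p0010 L45): «For any `nℓ ∈ 𝓝`:
if `loc_ℓ(𝓗̄(n)^±) ≠ 0` then `ρ(nℓ)^± = ρ(n)^± − 1` and `loc_ℓ(𝓗̄(nℓ)^±) = 0`; if `loc_ℓ(𝓗̄(n)^±) = 0` then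
`ρ(nℓ)^± = ρ(n)^± + 1`.» Proof, second case (p0010 L22–45): «the localization of `H¹_{𝓕^ℓ(n)}(K, T̄)^±`
at `ℓ` is a maximal isotropic subspace of `H¹(K_ℓ, T̄)^±` and an elementary linear algebra exercise shows
that the only two such subspaces are `H¹_f(K_ℓ, T̄)^±` and `H¹_tr(K_ℓ, T̄)^±`. Therefore
`H¹_{𝓕^ℓ(n)}(K, T̄)^±` is equal to either `H¹_{𝓕(n)}(K, T̄)^±` or `H¹_{𝓕(nℓ)}(K, T̄)^±`.»

DICTIONARY (one sign `ε` at a time). `W := H¹_{𝓕^ℓ(n)}(K, T̄)^ε` (relaxed at `ℓ`), `V := H¹(K_ℓ, T̄)^ε`,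
`loc : W →ₗ V` the localization, `Lf := H¹_f(K_ℓ, T̄)^ε`, `Lt := H¹_tr(K_ℓ, T̄)^ε` (disjoint lines), so that
`𝓗̄(n)^ε = loc⁻¹(Lf)` (`Submodule.comap loc Lf`), `𝓗̄(nℓ)^ε = loc⁻¹(Lt)`, `𝓗̄_ℓ(n)^ε = ker loc`, and
`ρ(·)^ε = finrank`. The Galois inputs become: **(GD)** `loc(W) ≠ 0` (indeed `finrank loc(W) = 1`: the
Poitou–Tate complement statement for the pair `𝓕_ℓ(n) ≤ 𝓕(n)` read on the `ε`-eigenline pair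
`H¹_f(K_ℓ, T̄)^ε × H¹_s(K_ℓ, T̄)^ε` says `dim loc(𝓗̄(n)^ε) + dim (loc(W) mod H¹_f) = 1 = dim loc(W)`);
**(ISO)** `loc(W)` is isotropic for the symmetric `τ`-twisted local pairing `B(x, y) = ⟨x, τy⟩_ℓ` (reciprocity
law + isotropy of `𝓕(n)` by H.4, p0010 L27–33), `Lf`, `Lt` being isotropic with `B` non-degenerate across them.

WHAT IS PROVED.
* §1 `AddSubgroup`/`Submodule` bookkeeping: a submodule contained in the union of two submodules lies in
  one of them (`Submodule.le_or_le_of_subset_union`).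
* §2 **the «elementary linear algebra exercise»** (`Submodule.le_or_le_of_isotropic`): for a bilinear
  `B : V × V → P`, submodules `Lf`, `Lt` with `B(x, x) = 0` on each and `B(u, v) + B(v, u) ≠ 0` for non-zero
  `u ∈ Lf`, `v ∈ Lt`, every submodule `S ≤ Lf ⊔ Lt` on which `B(x, x) = 0` satisfies `S ≤ Lf ∨ S ≤ Lt`
  (for `x = u + v`, `B(x, x) = B(u, v) + B(v, u)`; any commutative ring of scalars, no «`2 ≠ 0`» needed
  beyond the cross-pairing hypothesis).
* §3 **the dichotomy** (`range_le_and_comap_eq_of_map_comap_ne_bot`, `…_of_map_comap_eq_bot`): with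
  `Disjoint Lf Lt` and `range loc ≤ Lf ∨ range loc ≤ Lt` — if `loc(loc⁻¹ Lf) ≠ 0` then `range loc ≤ Lf`,
  `loc⁻¹ Lf = ⊤`, `loc⁻¹ Lt = ker loc`; if `loc(loc⁻¹ Lf) = 0` and `loc(W) ≠ 0` then `range loc ≤ Lt`,
  `loc⁻¹ Lt = ⊤`, `loc⁻¹ Lf = ker loc`.
* §4 **the counting** over a division ring with `W` finite-dimensional (`finrank_comap_add_finrank_range_eq_of_…`,
  and with `finrank (range loc) = 1` Howard's `ρ(nℓ)^ε = ρ(n)^ε ∓ 1`: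
  `finrank_comap_add_one_eq_of_map_comap_ne_bot`, `finrank_comap_eq_add_one_of_map_comap_eq_bot`).

NOT HERE: anything Galois-cohomological (the inputs (GD), (ISO), the eigenline dimensions, `τ`);
`thm161_dvrKolyvaginBound` is NOT proved by this file; no summit statement is proved; the
Birch–Swinnerton-Dyer conjecture is not proved by any of this.
References: [Howard2004HeegnerKolyvagin] Lemma 1.5.3 (arXiv 2.5.3), Prop. 1.1.9, Thm. 1.1.11 (arXiv 2.1.11).
-/

set_option autoImplicit false

namespace Literature.Algebra.Module

universe u v w

open Submodule

/-! ### §1 A submodule inside the union of two submodules lies in one of them -/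

section Union

variable {R : Type u} [Ring R] {V : Type v} [AddCommGroup V] [Module R V]

/-- A submodule contained in the UNION of two submodules is contained in one of them (an additive group
is never the union of two proper subgroups: if `x ∈ S ∖ A` and `y ∈ S ∖ B` then `x + y` lies in neither) —
the group-theoretic half of Howard's «elementary linear algebra exercise».
[cite: Howard2004HeegnerKolyvagin, Lemma 1.5.3 proof (arXiv 2.5.3, p. 10 L34–40: «an elementary linear algebra exercise shows that the only two such subspaces are …»)] -/
theorem Submodule.le_or_le_of_subset_union (S A B : Submodule R V)
    (h : (S : Set V) ⊆ (A : Set V) ∪ (B : Set V)) : S ≤ A ∨ S ≤ B := by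
  by_contra hcon
  rw [not_or] at hcon
  obtain ⟨hA, hB⟩ := hcon
  obtain ⟨x, hxS, hxA⟩ := Set.not_subset.mp hA
  obtain ⟨y, hyS, hyB⟩ := Set.not_subset.mp hB
  have hxB : x ∈ B := (h hxS).resolve_left hxA
  have hyA : y ∈ A := (h hyS).resolve_right hyB
  rcases h (S.add_mem hxS hyS) with hxy | hxy
  · exact hxA (by simpa using A.sub_mem hxy hyA)
  · exact hyB (by simpa using B.sub_mem hxy hxB)

end Union

/-! ### §2 The «elementary linear algebra exercise»: isotropic submodules of `Lf ⊔ Lt` -/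

section Isotropic

variable {R : Type u} [CommRing R] {V : Type v} [AddCommGroup V] [Module R V]
  {P : Type w} [AddCommGroup P] [Module R P]

/-- For `x = u + v` with `u`, `v` isotropic: `B(x, x) = B(u, v) + B(v, u)`.
[cite: Howard2004HeegnerKolyvagin, Lemma 1.5.3 proof (arXiv 2.5.3, p. 10 L34–38: «an elementary linear algebra exercise»)] -/
theorem bilin_apply_add_self_of_isotropic (B : V →ₗ[R] V →ₗ[R] P) {u v : V} (hu : B u u = 0)
    (hv : B v v = 0) : B (u + v) (u + v) = B u v + B v u := by
  simp only [map_add, LinearMap.add_apply, hu, hv, zero_add, add_zero]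
  exact add_comm _ _

/-- **Isotropic submodules of a split plane lie in one of the two isotropic summands** (Howard's
«elementary linear algebra exercise»): let `B : V × V → P` be bilinear, `Lf`, `Lt ≤ V` submodules on each
of which `B(x, x) = 0`, such that `B(u, v) + B(v, u) ≠ 0` whenever `u ∈ Lf`, `v ∈ Lt` are both non-zero.
Then every submodule `S ≤ Lf ⊔ Lt` with `B(x, x) = 0` for all `x ∈ S` satisfies `S ≤ Lf` or `S ≤ Lt`.
(For `x = u + v ∈ S`: `0 = B(x, x) = B(u, v) + B(v, u)`, so `u = 0` or `v = 0`; then §1.)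
[cite: Howard2004HeegnerKolyvagin, Lemma 1.5.3 proof (arXiv 2.5.3, p. 10 L34–40: «the only two such subspaces are `H¹_f(K_ℓ, T̄)^±` and `H¹_tr(K_ℓ, T̄)^±`»)] -/
theorem Submodule.le_or_le_of_isotropic (B : V →ₗ[R] V →ₗ[R] P) (Lf Lt S : Submodule R V)
    (hf : ∀ u ∈ Lf, B u u = 0) (ht : ∀ v ∈ Lt, B v v = 0)
    (hcross : ∀ u ∈ Lf, ∀ v ∈ Lt, u ≠ 0 → v ≠ 0 → B u v + B v u ≠ 0)
    (hS : S ≤ Lf ⊔ Lt) (hiso : ∀ x ∈ S, B x x = 0) : S ≤ Lf ∨ S ≤ Lt := by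
  refine Submodule.le_or_le_of_subset_union S Lf Lt fun x hx => ?_
  obtain ⟨u, hu, v, hv, rfl⟩ := Submodule.mem_sup.mp (hS hx)
  have h0 : B u v + B v u = 0 := by
    rw [← bilin_apply_add_self_of_isotropic B (hf u hu) (ht v hv)]
    exact hiso _ hx
  by_cases hu0 : u = 0
  · right
    simpa [hu0] using hv
  · by_cases hv0 : v = 0
    · left
      simpa [hv0] using hu
    · exact absurd h0 (hcross u hu v hv hu0 hv0)

/-- The same for the range of a linear map `loc : W → V` whose image is isotropic (the shape in which
Howard uses it: `loc = loc_ℓ` on `H¹_{𝓕^ℓ(n)}(K, T̄)^±`, isotropic by the reciprocity law and H.4).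
[cite: Howard2004HeegnerKolyvagin, Lemma 1.5.3 proof (arXiv 2.5.3, p. 10 L27–40)] -/
theorem LinearMap.range_le_or_range_le_of_isotropic {W : Type w} [AddCommGroup W] [Module R W]
    {P' : Type v} [AddCommGroup P'] [Module R P'] (B : V →ₗ[R] V →ₗ[R] P')
    (loc : W →ₗ[R] V) (Lf Lt : Submodule R V)
    (hf : ∀ u ∈ Lf, B u u = 0) (ht : ∀ v ∈ Lt, B v v = 0)
    (hcross : ∀ u ∈ Lf, ∀ v ∈ Lt, u ≠ 0 → v ≠ 0 → B u v + B v u ≠ 0)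
    (hrange : LinearMap.range loc ≤ Lf ⊔ Lt) (hiso : ∀ x y : W, B (loc x) (loc y) = 0) :
    LinearMap.range loc ≤ Lf ∨ LinearMap.range loc ≤ Lt := by
  refine Submodule.le_or_le_of_isotropic B Lf Lt _ hf ht hcross hrange fun x hx => ?_
  obtain ⟨y, rfl⟩ := LinearMap.mem_range.mp hx
  exact hiso y y

end Isotropic

/-! ### §3 The dichotomy of Lemma 1.5.3 for `loc : W → V` and two disjoint submodules `Lf`, `Lt` -/

section Dichotomy

variable {R : Type u} [Semiring R] {W : Type w} {V : Type v} [AddCommGroup W] [Module R W]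
  [AddCommGroup V] [Module R V]

/-- If `range loc ≤ Lf` then `loc⁻¹(Lf)` is everything.
[cite: Howard2004HeegnerKolyvagin, Lemma 1.5.3 proof (arXiv 2.5.3, p. 10 L16–19)] -/
theorem Submodule.comap_eq_top_of_range_le (loc : W →ₗ[R] V) {L : Submodule R V}
    (h : LinearMap.range loc ≤ L) : L.comap loc = ⊤ :=
  eq_top_iff.mpr fun x _ => h (LinearMap.mem_range_self loc x)

/-- If `range loc ≤ Lf` and `Lf`, `Lt` are disjoint then `loc⁻¹(Lt) = ker loc`.
[cite: Howard2004HeegnerKolyvagin, Lemma 1.5.3 proof (arXiv 2.5.3, p. 10 L16–19: «therefore `H¹_{𝓕_ℓ(n)}(K, T̄)^± = H¹_{𝓕(ℓn)}(K, T̄)^±`»)] -/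
theorem Submodule.comap_eq_ker_of_range_le_of_disjoint (loc : W →ₗ[R] V) {Lf Lt : Submodule R V}
    (hdis : Disjoint Lf Lt) (h : LinearMap.range loc ≤ Lf) : Lt.comap loc = LinearMap.ker loc := by
  refine le_antisymm (fun x hx => ?_) fun x hx => ?_
  · rw [LinearMap.mem_ker]
    rw [Submodule.mem_comap] at hx
    exact (Submodule.disjoint_def.mp hdis) _ (h (LinearMap.mem_range_self loc x)) hx
  · rw [LinearMap.mem_ker] at hx
    rw [Submodule.mem_comap, hx]
    exact Lt.zero_mem

/-- **Lemma 1.5.3, first case** (module form): `Lf`, `Lt` disjoint, `range loc ≤ Lf ∨ range loc ≤ Lt`, and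
`loc(loc⁻¹ Lf) ≠ 0` («`loc_ℓ(𝓗̄(n)^±) ≠ 0`») ⟹ `range loc ≤ Lf`, `loc⁻¹ Lf = ⊤` and `loc⁻¹ Lt = ker loc`
(«`𝓗̄(n)^± = 𝓗̄^ℓ(n)^±` and `𝓗̄(nℓ)^± = 𝓗̄_ℓ(n)^±`», in particular `loc(loc⁻¹ Lt) = 0`).
[cite: Howard2004HeegnerKolyvagin, Lemma 1.5.3 (a) (arXiv 2.5.3, p. 9 L141–143; proof p. 10 L1–19)] -/
theorem LinearMap.range_le_and_comap_eq_of_map_comap_ne_bot (loc : W →ₗ[R] V) {Lf Lt : Submodule R V}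
    (hdis : Disjoint Lf Lt) (hor : LinearMap.range loc ≤ Lf ∨ LinearMap.range loc ≤ Lt)
    (hne : (Lf.comap loc).map loc ≠ ⊥) :
    LinearMap.range loc ≤ Lf ∧ Lf.comap loc = ⊤ ∧ Lt.comap loc = LinearMap.ker loc := by
  have hLf : LinearMap.range loc ≤ Lf := by
    refine hor.resolve_right fun hLt => hne ?_
    rw [Submodule.comap_eq_ker_of_range_le_of_disjoint loc hdis.symm hLt, eq_bot_iff]
    rintro _ ⟨x, hx, rfl⟩
    rw [SetLike.mem_coe, LinearMap.mem_ker] at hx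
    rw [hx]
    exact Submodule.zero_mem _
  exact ⟨hLf, Submodule.comap_eq_top_of_range_le loc hLf,
    Submodule.comap_eq_ker_of_range_le_of_disjoint loc hdis hLf⟩

/-- **Lemma 1.5.3, second case** (module form): `Lf`, `Lt` disjoint, `range loc ≤ Lf ∨ range loc ≤ Lt`,
`loc(loc⁻¹ Lf) = 0` («`loc_ℓ(𝓗̄(n)^±) = 0`») and `loc(W) ≠ 0` (global duality) ⟹ `range loc ≤ Lt`,
`loc⁻¹ Lt = ⊤` and `loc⁻¹ Lf = ker loc` («`H¹_{𝓕^ℓ(n)}(K, T̄)^± = H¹_{𝓕(nℓ)}(K, T̄)^±`»).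
[cite: Howard2004HeegnerKolyvagin, Lemma 1.5.3 (b) (arXiv 2.5.3, p. 9 L145–146; proof p. 10 L21–45)] -/
theorem LinearMap.range_le_and_comap_eq_of_map_comap_eq_bot (loc : W →ₗ[R] V) {Lf Lt : Submodule R V}
    (hdis : Disjoint Lf Lt) (hor : LinearMap.range loc ≤ Lf ∨ LinearMap.range loc ≤ Lt)
    (heq : (Lf.comap loc).map loc = ⊥) (hW : LinearMap.range loc ≠ ⊥) :
    LinearMap.range loc ≤ Lt ∧ Lt.comap loc = ⊤ ∧ Lf.comap loc = LinearMap.ker loc := by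
  have hLt : LinearMap.range loc ≤ Lt := by
    refine hor.resolve_left fun hLf => hW ?_
    rw [← heq, Submodule.comap_eq_top_of_range_le loc hLf, Submodule.map_top]
  exact ⟨hLt, Submodule.comap_eq_top_of_range_le loc hLt,
    Submodule.comap_eq_ker_of_range_le_of_disjoint loc hdis.symm hLt⟩

/-- Reading the hypothesis «`loc_ℓ(𝓗̄(n)^±) = 0`», i.e. `loc(loc⁻¹ Lf) = 0`, elementwise.
[cite: Howard2004HeegnerKolyvagin, Lemma 1.5.3 (b) (arXiv 2.5.3, p. 9 L145: «if `loc_ℓ(𝓗̄(n)^±) = 0` then …»)] -/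
theorem Submodule.map_comap_eq_bot_iff (loc : W →ₗ[R] V) (L : Submodule R V) :
    (L.comap loc).map loc = ⊥ ↔ ∀ x : W, loc x ∈ L → loc x = 0 := by
  rw [eq_bot_iff]
  constructor
  · intro h x hx
    exact (Submodule.mem_bot R).mp (h (Submodule.mem_map_of_mem hx))
  · rintro h _ ⟨x, hx, rfl⟩
    exact (Submodule.mem_bot R).mpr (h x hx)

end Dichotomy

/-! ### §4 The counting: `ρ(nℓ)^± = ρ(n)^± ∓ 1` -/

section Counting

variable {F : Type u} [DivisionRing F] {W : Type w} {V : Type v} [AddCommGroup W] [Module F W]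
  [AddCommGroup V] [Module F V] [FiniteDimensional F W]

/-- `finrank (ker loc) + finrank (range loc) = finrank ⊤` (rank–nullity, with `⊤ ≤ W` as a submodule).
[folklore] -/
private theorem LinearMap.finrank_ker_add_finrank_range_eq_finrank_top (loc : W →ₗ[F] V) :
    Module.finrank F (LinearMap.ker loc) + Module.finrank F (LinearMap.range loc) =
      Module.finrank F (⊤ : Submodule F W) := by
  rw [_root_.finrank_top, add_comm]
  exact LinearMap.finrank_range_add_finrank_ker loc

/-- **Lemma 1.5.3, first case, counted**: under the hypotheses of
`LinearMap.range_le_and_comap_eq_of_map_comap_ne_bot`,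
`finrank loc⁻¹(Lt) + finrank (range loc) = finrank loc⁻¹(Lf)` and `loc(loc⁻¹ Lt) = 0`.
[cite: Howard2004HeegnerKolyvagin, Lemma 1.5.3 (a) (arXiv 2.5.3, p. 9 L141–143)] -/
theorem LinearMap.finrank_comap_add_finrank_range_eq_of_map_comap_ne_bot (loc : W →ₗ[F] V)
    {Lf Lt : Submodule F V} (hdis : Disjoint Lf Lt)
    (hor : LinearMap.range loc ≤ Lf ∨ LinearMap.range loc ≤ Lt) (hne : (Lf.comap loc).map loc ≠ ⊥) :
    Module.finrank F (Lt.comap loc) + Module.finrank F (LinearMap.range loc) = Module.finrank F (Lf.comap loc) ∧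
      (Lt.comap loc).map loc = ⊥ := by
  obtain ⟨-, hf, ht⟩ := LinearMap.range_le_and_comap_eq_of_map_comap_ne_bot loc hdis hor hne
  refine ⟨?_, ?_⟩
  · rw [hf, ht]
    exact LinearMap.finrank_ker_add_finrank_range_eq_finrank_top loc
  · rw [ht, eq_bot_iff]
    rintro _ ⟨x, hx, rfl⟩
    rw [SetLike.mem_coe, LinearMap.mem_ker] at hx
    rw [hx]
    exact Submodule.zero_mem _

/-- **Lemma 1.5.3, second case, counted**: under the hypotheses of
`LinearMap.range_le_and_comap_eq_of_map_comap_eq_bot`,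
`finrank loc⁻¹(Lt) = finrank loc⁻¹(Lf) + finrank (range loc)`.
[cite: Howard2004HeegnerKolyvagin, Lemma 1.5.3 (b) (arXiv 2.5.3, p. 9 L145–146)] -/
theorem LinearMap.finrank_comap_eq_finrank_comap_add_finrank_range_of_map_comap_eq_bot
    (loc : W →ₗ[F] V) {Lf Lt : Submodule F V} (hdis : Disjoint Lf Lt)
    (hor : LinearMap.range loc ≤ Lf ∨ LinearMap.range loc ≤ Lt)
    (heq : (Lf.comap loc).map loc = ⊥) (hW : LinearMap.range loc ≠ ⊥) :
    Module.finrank F (Lt.comap loc) = Module.finrank F (Lf.comap loc) + Module.finrank F (LinearMap.range loc) := by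
  obtain ⟨-, ht, hf⟩ := LinearMap.range_le_and_comap_eq_of_map_comap_eq_bot loc hdis hor heq hW
  rw [hf, ht]
  exact (LinearMap.finrank_ker_add_finrank_range_eq_finrank_top loc).symm

/-- **Howard's Lemma 1.5.3 (a) in numbers**: with `finrank (range loc) = 1` (the eigenline form of global
duality), `loc(loc⁻¹ Lf) ≠ 0 ⟹ finrank loc⁻¹(Lt) + 1 = finrank loc⁻¹(Lf)` and `loc(loc⁻¹ Lt) = 0` — i.e.
«`ρ(nℓ)^± = ρ(n)^± − 1` and `loc_ℓ(𝓗̄(nℓ)^±) = 0`».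
[cite: Howard2004HeegnerKolyvagin, Lemma 1.5.3 (a) (arXiv 2.5.3, p. 9 L141–143)] -/
theorem LinearMap.finrank_comap_add_one_eq_of_map_comap_ne_bot (loc : W →ₗ[F] V)
    {Lf Lt : Submodule F V} (hdis : Disjoint Lf Lt)
    (hor : LinearMap.range loc ≤ Lf ∨ LinearMap.range loc ≤ Lt)
    (h1 : Module.finrank F (LinearMap.range loc) = 1) (hne : (Lf.comap loc).map loc ≠ ⊥) :
    Module.finrank F (Lt.comap loc) + 1 = Module.finrank F (Lf.comap loc) ∧ (Lt.comap loc).map loc = ⊥ := by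
  have h := LinearMap.finrank_comap_add_finrank_range_eq_of_map_comap_ne_bot loc hdis hor hne
  rw [h1] at h
  exact h

/-- **Howard's Lemma 1.5.3 (b) in numbers**: with `finrank (range loc) = 1`,
`loc(loc⁻¹ Lf) = 0 ⟹ finrank loc⁻¹(Lt) = finrank loc⁻¹(Lf) + 1` — i.e. «`ρ(nℓ)^± = ρ(n)^± + 1`».
[cite: Howard2004HeegnerKolyvagin, Lemma 1.5.3 (b) (arXiv 2.5.3, p. 9 L145–146)] -/
theorem LinearMap.finrank_comap_eq_add_one_of_map_comap_eq_bot (loc : W →ₗ[F] V)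
    {Lf Lt : Submodule F V} (hdis : Disjoint Lf Lt)
    (hor : LinearMap.range loc ≤ Lf ∨ LinearMap.range loc ≤ Lt)
    (h1 : Module.finrank F (LinearMap.range loc) = 1) (heq : (Lf.comap loc).map loc = ⊥) :
    Module.finrank F (Lt.comap loc) = Module.finrank F (Lf.comap loc) + 1 := by
  have hW : LinearMap.range loc ≠ ⊥ := by
    intro h
    rw [h, _root_.finrank_bot] at h1
    exact zero_ne_one h1
  rw [← h1]
  exact LinearMap.finrank_comap_eq_finrank_comap_add_finrank_range_of_map_comap_eq_bot loc hdis hor heq hW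

/-- **The parity statement** «`ρ(n) mod 2` is independent of `n`» in its one-step form: in either case
`finrank loc⁻¹(Lt) + finrank loc⁻¹(Lf)` is odd… more precisely the two ranks differ by exactly one:
`finrank loc⁻¹(Lt) + 1 = finrank loc⁻¹(Lf) ∨ finrank loc⁻¹(Lt) = finrank loc⁻¹(Lf) + 1`.
[cite: Howard2004HeegnerKolyvagin, Lemma 1.5.3 (arXiv 2.5.3, p. 9 L147–148: «In particular this implies that `ρ(n) (mod 2)` is independent of `n ∈ 𝓝`»)] -/
theorem LinearMap.finrank_comap_add_one_eq_or_eq_add_one (loc : W →ₗ[F] V) {Lf Lt : Submodule F V}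
    (hdis : Disjoint Lf Lt) (hor : LinearMap.range loc ≤ Lf ∨ LinearMap.range loc ≤ Lt)
    (h1 : Module.finrank F (LinearMap.range loc) = 1) :
    Module.finrank F (Lt.comap loc) + 1 = Module.finrank F (Lf.comap loc) ∨
      Module.finrank F (Lt.comap loc) = Module.finrank F (Lf.comap loc) + 1 := by
  by_cases hne : (Lf.comap loc).map loc = ⊥
  · exact Or.inr (LinearMap.finrank_comap_eq_add_one_of_map_comap_eq_bot loc hdis hor h1 hne)
  · exact Or.inl (LinearMap.finrank_comap_add_one_eq_of_map_comap_ne_bot loc hdis hor h1 hne).1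

end Counting

/-! ### §5 The counting with `Module.length` (any ring of scalars)

For consumers whose `ρ(n)^±` is a LENGTH (`Module.length R` of the eigen-Selmer module over the
level ring `R_k` or over `R`, the residue field acting through `R → R/𝔪`) rather than a `finrank` over
a field: the same identities with `Module.length` (values in `ℕ∞`), no division ring and no
finiteness assumption needed (rank–nullity = additivity of length on `0 → ker → W → range → 0`). -/

section Length

variable {R : Type u} [Ring R] {W : Type w} {V : Type v} [AddCommGroup W] [Module R W]
  [AddCommGroup V] [Module R V]

/-- `length (ker loc) + length (range loc) = length ⊤` (additivity of length). [folklore] -/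
private theorem LinearMap.length_ker_add_length_range_eq_length_top (loc : W →ₗ[R] V) :
    Module.length R (LinearMap.ker loc) + Module.length R (LinearMap.range loc) =
      Module.length R (⊤ : Submodule R W) := by
  rw [Submodule.topEquiv.length_eq, ← LinearMap.ker_rangeRestrict loc]
  exact (Module.length_eq_add_of_exact (LinearMap.ker loc.rangeRestrict).subtype loc.rangeRestrict
    (Submodule.subtype_injective _) loc.surjective_rangeRestrict
    (LinearMap.exact_subtype_ker_map _)).symm

/-- **Lemma 1.5.3, first case, counted in lengths**: under the hypotheses of
`LinearMap.range_le_and_comap_eq_of_map_comap_ne_bot`,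
`length loc⁻¹(Lt) + length (range loc) = length loc⁻¹(Lf)` and `loc(loc⁻¹ Lt) = 0`.
[cite: Howard2004HeegnerKolyvagin, Lemma 1.5.3 (a) (arXiv 2.5.3, p. 9 L141–143)] -/
theorem LinearMap.length_comap_add_length_range_eq_of_map_comap_ne_bot (loc : W →ₗ[R] V)
    {Lf Lt : Submodule R V} (hdis : Disjoint Lf Lt)
    (hor : LinearMap.range loc ≤ Lf ∨ LinearMap.range loc ≤ Lt) (hne : (Lf.comap loc).map loc ≠ ⊥) :
    Module.length R (Lt.comap loc) + Module.length R (LinearMap.range loc) =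
        Module.length R (Lf.comap loc) ∧
      (Lt.comap loc).map loc = ⊥ := by
  obtain ⟨-, hf, ht⟩ := LinearMap.range_le_and_comap_eq_of_map_comap_ne_bot loc hdis hor hne
  refine ⟨?_, ?_⟩
  · rw [hf, ht]
    exact LinearMap.length_ker_add_length_range_eq_length_top loc
  · rw [ht, eq_bot_iff]
    rintro _ ⟨x, hx, rfl⟩
    rw [SetLike.mem_coe, LinearMap.mem_ker] at hx
    rw [hx]
    exact Submodule.zero_mem _

/-- **Lemma 1.5.3, second case, counted in lengths**: under the hypotheses of
`LinearMap.range_le_and_comap_eq_of_map_comap_eq_bot`,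
`length loc⁻¹(Lt) = length loc⁻¹(Lf) + length (range loc)`.
[cite: Howard2004HeegnerKolyvagin, Lemma 1.5.3 (b) (arXiv 2.5.3, p. 9 L145–146)] -/
theorem LinearMap.length_comap_eq_length_comap_add_length_range_of_map_comap_eq_bot
    (loc : W →ₗ[R] V) {Lf Lt : Submodule R V} (hdis : Disjoint Lf Lt)
    (hor : LinearMap.range loc ≤ Lf ∨ LinearMap.range loc ≤ Lt)
    (heq : (Lf.comap loc).map loc = ⊥) (hW : LinearMap.range loc ≠ ⊥) :
    Module.length R (Lt.comap loc) =
      Module.length R (Lf.comap loc) + Module.length R (LinearMap.range loc) := by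
  obtain ⟨-, ht, hf⟩ := LinearMap.range_le_and_comap_eq_of_map_comap_eq_bot loc hdis hor heq hW
  rw [hf, ht]
  exact (LinearMap.length_ker_add_length_range_eq_length_top loc).symm

/-- **Howard's Lemma 1.5.3 (a) in lengths**: with `length (range loc) = 1` (the eigenline form of
global duality), `loc(loc⁻¹ Lf) ≠ 0 ⟹ length loc⁻¹(Lt) + 1 = length loc⁻¹(Lf)` and
`loc(loc⁻¹ Lt) = 0` — «`ρ(nℓ)^± = ρ(n)^± − 1` and `loc_ℓ(𝓗̄(nℓ)^±) = 0`».
[cite: Howard2004HeegnerKolyvagin, Lemma 1.5.3 (a) (arXiv 2.5.3, p. 9 L141–143)] -/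
theorem LinearMap.length_comap_add_one_eq_of_map_comap_ne_bot (loc : W →ₗ[R] V)
    {Lf Lt : Submodule R V} (hdis : Disjoint Lf Lt)
    (hor : LinearMap.range loc ≤ Lf ∨ LinearMap.range loc ≤ Lt)
    (h1 : Module.length R (LinearMap.range loc) = 1) (hne : (Lf.comap loc).map loc ≠ ⊥) :
    Module.length R (Lt.comap loc) + 1 = Module.length R (Lf.comap loc) ∧
      (Lt.comap loc).map loc = ⊥ := by
  have h := LinearMap.length_comap_add_length_range_eq_of_map_comap_ne_bot loc hdis hor hne
  rw [h1] at h
  exact h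

/-- **Howard's Lemma 1.5.3 (b) in lengths**: with `length (range loc) = 1`,
`loc(loc⁻¹ Lf) = 0 ⟹ length loc⁻¹(Lt) = length loc⁻¹(Lf) + 1` — «`ρ(nℓ)^± = ρ(n)^± + 1`».
[cite: Howard2004HeegnerKolyvagin, Lemma 1.5.3 (b) (arXiv 2.5.3, p. 9 L145–146)] -/
theorem LinearMap.length_comap_eq_add_one_of_map_comap_eq_bot (loc : W →ₗ[R] V)
    {Lf Lt : Submodule R V} (hdis : Disjoint Lf Lt)
    (hor : LinearMap.range loc ≤ Lf ∨ LinearMap.range loc ≤ Lt)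
    (h1 : Module.length R (LinearMap.range loc) = 1) (heq : (Lf.comap loc).map loc = ⊥) :
    Module.length R (Lt.comap loc) = Module.length R (Lf.comap loc) + 1 := by
  have hW : LinearMap.range loc ≠ ⊥ := by
    intro h
    have h0 : Module.length R (LinearMap.range loc) = 0 := by
      rw [h]
      exact Module.length_bot
    rw [h0] at h1
    exact zero_ne_one h1
  rw [← h1]
  exact LinearMap.length_comap_eq_length_comap_add_length_range_of_map_comap_eq_bot loc hdis hor
    heq hW

/-- **The parity statement in lengths**: with `length (range loc) = 1` the two lengths differ by
exactly one: `length loc⁻¹(Lt) + 1 = length loc⁻¹(Lf) ∨ length loc⁻¹(Lt) = length loc⁻¹(Lf) + 1`.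
[cite: Howard2004HeegnerKolyvagin, Lemma 1.5.3 (arXiv 2.5.3, p. 9 L147–148: «`ρ(n) (mod 2)` is independent of `n`»)] -/
theorem LinearMap.length_comap_add_one_eq_or_eq_add_one (loc : W →ₗ[R] V) {Lf Lt : Submodule R V}
    (hdis : Disjoint Lf Lt) (hor : LinearMap.range loc ≤ Lf ∨ LinearMap.range loc ≤ Lt)
    (h1 : Module.length R (LinearMap.range loc) = 1) :
    Module.length R (Lt.comap loc) + 1 = Module.length R (Lf.comap loc) ∨
      Module.length R (Lt.comap loc) = Module.length R (Lf.comap loc) + 1 := by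
  by_cases hne : (Lf.comap loc).map loc = ⊥
  · exact Or.inr (LinearMap.length_comap_eq_add_one_of_map_comap_eq_bot loc hdis hor h1 hne)
  · exact Or.inl (LinearMap.length_comap_add_one_eq_of_map_comap_ne_bot loc hdis hor h1 hne).1

end Length

/-! ### §6 The dichotomy in the presence of an involution (eigen-cut version of §2)

In Howard's Lemma 1.5.3 the split plane is the `ε`-eigenpart `V^ε = V_f^ε ⊕ V_tr^ε` of
`V = H¹(K_ℓ, T̄) = H¹_f ⊕ H¹_tr` under the local complex conjugation `τ_ℓ`, and the isotropic
submodule is the image of the `ε`-eigen-Selmer group, which consists of `ε`-eigenvectors. The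
version below takes the UNCUT summands `Lf`, `Lt` (stable under an endomorphism `τ`), an `S` made of
`ε`-eigenvectors of `τ`, and asks the cross-pairing non-degeneracy only on the `ε`-eigenvectors of
`Lf` and `Lt` (the eigenLINES): the components of an eigenvector are eigenvectors
(`eigen_components_of_disjoint`), so §2 applies to `Lf ∩ ker(τ − ε)`, `Lt ∩ ker(τ − ε)`. -/

section EigenCut

variable {R : Type u} [CommRing R] {V : Type v} [AddCommGroup V] [Module R V]
  {P : Type w} [AddCommGroup P] [Module R P]

/-- **Components of an eigenvector are eigenvectors**: if `Lf`, `Lt` are disjoint `τ`-stable submodules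
and `x = u + v` (`u ∈ Lf`, `v ∈ Lt`) with `τ x = ε • x`, then `τ u = ε • u` and `τ v = ε • v`.
[cite: Howard2004HeegnerKolyvagin, Lemma 1.5.3 proof (arXiv 2.5.3, p. 10 L12–16: «complex conjugation splits `H¹_f(K_ℓ, T̄)` and `H¹_s(K_ℓ, T̄)` each into … eigenspaces»)] -/
theorem eigen_components_of_disjoint (τ : V →ₗ[R] V) (ε : R) {Lf Lt : Submodule R V}
    (hdis : Disjoint Lf Lt) (hstabf : ∀ u ∈ Lf, τ u ∈ Lf) (hstabt : ∀ v ∈ Lt, τ v ∈ Lt)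
    {u v : V} (hu : u ∈ Lf) (hv : v ∈ Lt) (hx : τ (u + v) = ε • (u + v)) :
    τ u = ε • u ∧ τ v = ε • v := by
  have hf' : τ u - ε • u ∈ Lf := Lf.sub_mem (hstabf u hu) (Lf.smul_mem ε hu)
  have ht' : τ v - ε • v ∈ Lt := Lt.sub_mem (hstabt v hv) (Lt.smul_mem ε hv)
  have hsum : (τ u - ε • u) + (τ v - ε • v) = 0 := by
    rw [map_add, smul_add] at hx
    rw [sub_add_sub_comm, hx, sub_self]
  have heq : τ u - ε • u = -(τ v - ε • v) := eq_neg_of_add_eq_zero_left hsum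
  have hmem : τ u - ε • u ∈ Lt := by
    rw [heq]
    exact Lt.neg_mem ht'
  have h0 : τ u - ε • u = 0 := (Submodule.disjoint_def.mp hdis) _ hf' hmem
  refine ⟨sub_eq_zero.mp h0, ?_⟩
  rw [h0, zero_add] at hsum
  exact sub_eq_zero.mp hsum

/-- **Lemma 1.5.3's «elementary linear algebra exercise», eigen-cut form.** Let `B : V × V → P` be
bilinear; `Lf`, `Lt ≤ V` disjoint, `τ`-stable, with `B(x, x) = 0` on each; suppose the cross-pairing is
non-degenerate on the `ε`-EIGENVECTORS: `B(u, v) + B(v, u) ≠ 0` for non-zero `u ∈ Lf`, `v ∈ Lt` with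
`τ u = ε u`, `τ v = ε v` (the eigenlines `V_f^ε`, `V_tr^ε` of a hyperbolic plane). Then every submodule
`S ≤ Lf ⊔ Lt` consisting of `ε`-eigenvectors of `τ` on which `B(x, x) = 0` satisfies `S ≤ Lf ∨ S ≤ Lt`.
[cite: Howard2004HeegnerKolyvagin, Lemma 1.5.3 proof (arXiv 2.5.3, p. 10 L34–40: «an elementary linear algebra exercise shows that the only two such subspaces are `H¹_f(K_ℓ, T̄)^±` and `H¹_tr(K_ℓ, T̄)^±`»)] -/
theorem Submodule.le_or_le_of_isotropic_of_eigen (B : V →ₗ[R] V →ₗ[R] P) (τ : V →ₗ[R] V) (ε : R)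
    (Lf Lt S : Submodule R V) (hdis : Disjoint Lf Lt)
    (hstabf : ∀ u ∈ Lf, τ u ∈ Lf) (hstabt : ∀ v ∈ Lt, τ v ∈ Lt)
    (hf : ∀ u ∈ Lf, B u u = 0) (ht : ∀ v ∈ Lt, B v v = 0)
    (hcross : ∀ u ∈ Lf, τ u = ε • u → ∀ v ∈ Lt, τ v = ε • v → u ≠ 0 → v ≠ 0 → B u v + B v u ≠ 0)
    (hS : S ≤ Lf ⊔ Lt) (heig : ∀ x ∈ S, τ x = ε • x) (hiso : ∀ x ∈ S, B x x = 0) :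
    S ≤ Lf ∨ S ≤ Lt := by
  -- the eigen-cut summands
  let E : Submodule R V := LinearMap.ker (τ - ε • (LinearMap.id : V →ₗ[R] V))
  have hE : ∀ x, x ∈ E ↔ τ x = ε • x := fun x => by
    change (τ - ε • (LinearMap.id : V →ₗ[R] V)) x = 0 ↔ _
    rw [LinearMap.sub_apply, LinearMap.smul_apply, LinearMap.id_apply, sub_eq_zero]
  have h := Submodule.le_or_le_of_isotropic B (Lf ⊓ E) (Lt ⊓ E) S
    (fun u hu => hf u hu.1) (fun v hv => ht v hv.1)
    (fun u hu v hv hu0 hv0 => hcross u hu.1 ((hE u).mp hu.2) v hv.1 ((hE v).mp hv.2) hu0 hv0)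
    (fun x hx => by
      obtain ⟨u, hu, v, hv, rfl⟩ := Submodule.mem_sup.mp (hS hx)
      obtain ⟨heu, hev⟩ := eigen_components_of_disjoint τ ε hdis hstabf hstabt hu hv (heig _ hx)
      exact Submodule.mem_sup.mpr ⟨u, ⟨hu, (hE u).mpr heu⟩, v, ⟨hv, (hE v).mpr hev⟩, rfl⟩)
    hiso
  rcases h with h | h
  · exact Or.inl (h.trans inf_le_left)
  · exact Or.inr (h.trans inf_le_left)

/-- The range form (the shape in which Howard uses it: `S = loc_ℓ (H¹_{𝓕^ℓ(n)}(K, T̄)^ε)`).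
[cite: Howard2004HeegnerKolyvagin, Lemma 1.5.3 proof (arXiv 2.5.3, p. 10 L27–40)] -/
theorem LinearMap.range_le_or_range_le_of_isotropic_of_eigen {W : Type w} [AddCommGroup W] [Module R W]
    {P' : Type v} [AddCommGroup P'] [Module R P'] (B : V →ₗ[R] V →ₗ[R] P') (τ : V →ₗ[R] V) (ε : R)
    (loc : W →ₗ[R] V) (Lf Lt : Submodule R V) (hdis : Disjoint Lf Lt)
    (hstabf : ∀ u ∈ Lf, τ u ∈ Lf) (hstabt : ∀ v ∈ Lt, τ v ∈ Lt)
    (hf : ∀ u ∈ Lf, B u u = 0) (ht : ∀ v ∈ Lt, B v v = 0)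
    (hcross : ∀ u ∈ Lf, τ u = ε • u → ∀ v ∈ Lt, τ v = ε • v → u ≠ 0 → v ≠ 0 → B u v + B v u ≠ 0)
    (hrange : LinearMap.range loc ≤ Lf ⊔ Lt) (heig : ∀ w : W, τ (loc w) = ε • loc w)
    (hiso : ∀ x y : W, B (loc x) (loc y) = 0) :
    LinearMap.range loc ≤ Lf ∨ LinearMap.range loc ≤ Lt := by
  refine Submodule.le_or_le_of_isotropic_of_eigen B τ ε Lf Lt _ hdis hstabf hstabt hf ht hcross hrange
    (fun x hx => ?_) (fun x hx => ?_)
  · obtain ⟨w, rfl⟩ := LinearMap.mem_range.mp hx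
    exact heig w
  · obtain ⟨w, rfl⟩ := LinearMap.mem_range.mp hx
    exact hiso w w

end EigenCut

end Literature.Algebra.Module
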